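import Literature.NumberTheory.ComplexMultiplication.CMTypeUniformizationDescendedMultiplications
import Literature.AlgebraicGeometry.Motives.AbelianVarietyGoodReductionHom
import Literature.AlgebraicGeometry.ComplexMultiplication.CMOrderCommutantAnyField
import Literature.RingTheory.DedekindDomain.FractionalIdealScalarMaps
import Literature.NumberTheory.ComplexMultiplication.ShimuraTaniyamaHecke
import HarnessLib

/-!
# An `𝔬`-equivariant isomorphism of the REDUCTIONS of two principal CM structures lifts to an isomorphism
# of the structures (Shimura 1998, proof of the Main Theorem 18.6, step «`θ̃ = ψ`», p0167 L13 – p0168 L3)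

Topic `NumberTheory/ComplexMultiplication`; namespace `Literature.NumberTheory.ComplexMultiplication` (grouping
sub-namespace `CMTypeUniformization`, the tree's structure).  ONE THEOREM (no definition, no named fact).  Cell
hodgecm-mathlib, fan B, rung B-II, row II-1 v2, stub S3 `stub_identification` (the statement below is the signature
proposed for the v2 skeleton, STATUS 2026-08-28T02:44Z; successor of B-p01's PREP/HANDOFF).  HC_CM is proved only
modulo the 7 printed citations until rung 0 closes; row II-1 is not one of the seven binders and nothing here changes
that.

## The statement (`CMTypeUniformization.exists_iso_redHom_eq_of_reduction_iso`)

Let `(A₀, ιA)`, `(B₀, ιB)` be abelian varieties over a number field `L ⊆ ℂ` with `𝓞_K`-actions whose base changes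
to `ℂ` are uniformised of types `(K, Φ; 𝔞)`, `(K, Φ; 𝔟)` (`CMTypeUniformization`, [Shimura1998] §18.4 (18.4a)), such
that every `ℂ`-homomorphism between them is `L`-rational (`hAB`, `hBA`: surjectivity of `Hom.baseChange ℂ`); let
`v` be a place of good reduction for both with reduction-of-homomorphisms data `H : Hom(A₀,B₀) → Hom(Ā,B̄)`,
`H' : Hom(B₀,A₀) → Hom(B̄,Ā)` compatible with one system of `ℓ`-adic specialisations (`IsTateCompatible`, `v ∤ ℓ`;
[Shimura1998] §11.1 Prop. 12, Prop. 14 (i)), and let `Ψ : Ā ≅ B̄` be an isomorphism of the reductions commuting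
with the reduced `𝔬`-actions.  THEN there is an isomorphism `θ : A₀ ≅ B₀` over `L`, `𝓞_K`-equivariant, whose
reduction is `Ψ`: `H.redHom θ = Ψ`.

This is the step of the proof of [Shimura1998] Thm. 18.6 (p0167 L13 – p0168 L3) in which the isomorphism
`ψ : (Ã_i, ι̃_i) → (Ã^σ, ι̃^σ)` of reductions (obtained from §13) is shown to be the reduction of an isomorphism
`θ : (A_i, ι_i) → (A^σ, ι^σ)`; Shimura argues through §7.4 Prop. 15–16 and §5.1 Prop. 1 («every element of
`End_Q(Ã)` commuting with `ι̃(F)` …», §13.2).  Here, following B-p01's plan, WITHOUT degrees or «`𝔠 = 1`»: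

## Proof («two-sided `c`-multiplications»)

* (M) For `c ∈ 𝔞⁻¹𝔟` the `c`-multiplication `m_c : A₀ → B₀` over `L` (the tree's
  `CMTypeUniformization.exists_hom_baseChange_map_r_eq`, [Shimura1998] §7.4 Prop. 15 over `ℂ` descended by `hAB`;
  `ι`-equivariant), similarly `m'_{c'} : B₀ → A₀` for `c' ∈ 𝔟⁻¹𝔞`, with `m_c ≫ m'_{c'} = ιA(cc')`
  (`CMTypeUniformization.comp_eq_of_forall_baseChange_map_r_eq`).
* (X) `H.redHom(m_c) ≫ Ψ⁻¹ ∈ End Ā` commutes with `ι̃A(𝔬)`, hence equals `ι̃A(γ₀ c)` for some `γ₀ c ∈ 𝓞_K` (the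
  tree's `GoodReductionAt.exists_redEnd_eq_of_forall_comp_eq`, §5.1 Prop. 1 over the residue field + integrality);
  (Y) likewise `Ψ ≫ H'.redHom(m'_{c'}) = ι̃A(γ₁ c')`.
* `γ₀(c) γ₁(c') = c c'`: the product of the two is `H.redHom(m_c) ≫ H'.redHom(m'_{c'}) = (m_c ≫ m'_{c'})~ = ι̃A(cc')`
  (`HomReduction.redEnd_comp_eq_redHom_comp_redHom`, §11.1 Prop. 12/14) and `ι̃A` is injective
  (`injective_of_finrank_eq_two_mul_dim`).
* (L) Two functions on `𝔞⁻¹𝔟` and its inverse with `γ₀(x)γ₁(y) = xy` and integral values are `g·` and `g⁻¹·` with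
  `𝔞⁻¹𝔟 = (g⁻¹)` (the tree's `FractionalIdeal.eq_spanSingleton_inv_of_forall_mul_eq`); so `g⁻¹ ∈ 𝔞⁻¹𝔟`, `g ∈ 𝔟⁻¹𝔞`,
  `γ₀(g⁻¹) = 1`.
* (θ) `θ := m_{g⁻¹}` with inverse `m'_g` (the two composites are `ιA(1)`, `ιB(1)`); `H.redHom θ ≫ Ψ⁻¹ = ι̃A(γ₀ g⁻¹) = 1`.

## References
* [Shimura1998] G. Shimura, *Abelian Varieties with Complex Multiplication and Modular Functions* (1998): §5.1
  Prop. 1; §7.4 Prop. 15–16 (p. 58); §11.1 Prop. 12–14; §13.2 Thm. 2; §18.4 (18.4a); §18.6 Thm. 18.6, proof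
  pp. 165–168 (corpus p0166 L5–12, p0167 L13 – p0168 L3).
-/

set_option autoImplicit false

noncomputable section

open CategoryTheory NumberField IsDedekindDomain
open scoped NumberField nonZeroDivisors
open Literature.AlgebraicGeometry.Motives Literature.AlgebraicGeometry.Motives.AbelianVariety
open Literature.AlgebraicGeometry.Motives.AbelianVariety.GoodReductionAt
open Literature.AlgebraicGeometry.ComplexMultiplication

namespace Literature.NumberTheory.ComplexMultiplication


/-! ### The identification `θ̃ = ψ` -/

section Identification

variable {K : Type} [Field K] [NumberField K]
  {L : Type} [Field L] [NumberField L] [Algebra L ℂ]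

/-- **An `𝔬`-equivariant isomorphism `Ψ : Ā ≅ B̄` of the reductions at a good place lifts to an `𝓞_K`-equivariant
isomorphism `θ : A₀ ≅ B₀` with `θ̃ = Ψ`** — for `(A₀, ιA)`, `(B₀, ιB)` over the number field `L ⊆ ℂ` whose base changes
to `ℂ` are uniformised of types `(K, Φ; 𝔞)`, `(K, Φ; 𝔟)`, all `ℂ`-homomorphisms between them `L`-rational (`hAB`, `hBA`),
and reduction data `H`, `H'` at `v` compatible with one `ℓ`-adic system (`v ∤ ℓ`).  [Shimura1998] proof of Thm. 18.6,
p0167 L13 – p0168 L3 («… an isomorphism `θ` of `(A_i, ι_i)` to `(A^σ, ι^σ)` … `θ̃ = ψ`»), via §7.4 Prop. 15–16,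
§5.1 Prop. 1 for the reduction (§13.2) and §11.1 Prop. 12; proof route of the module docstring (no degrees, no
«`𝔠 = 1`»: the unknown lattice `𝔟` of `B₀` turns out to be `g 𝔞`).
[cite: Shimura1998, §18.6 Thm. 18.6, proof p0167 L13 – p0168 L3; §7.4 Prop. 15–16 (p. 58); §13.2 Thm. 2; §11.1 Prop. 12]
[cite: SerreTate1968GoodReduction, §4 Cor. 1 of Thm. 5] -/
theorem CMTypeUniformization.exists_iso_redHom_eq_of_reduction_iso (Φ : CMType K) (𝔞 𝔟 : (FractionalIdeal (𝓞 K)⁰ K)ˣ)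
    (A₀ B₀ : AbelianVariety L) (ιA : 𝓞 K →+* End A₀) (ιB : 𝓞 K →+* End B₀)
    (ξA : CMTypeUniformization Φ 𝔞 (A₀.baseChange ℂ) ((endBaseChange ℂ A₀).comp ιA))
    (ξB : CMTypeUniformization Φ 𝔟 (B₀.baseChange ℂ) ((endBaseChange ℂ B₀).comp ιB))
    (hAB : Function.Surjective (Hom.baseChange ℂ : (A₀ ⟶ B₀) → (A₀.baseChange ℂ ⟶ B₀.baseChange ℂ)))
    (hBA : Function.Surjective (Hom.baseChange ℂ : (B₀ ⟶ A₀) → (B₀.baseChange ℂ ⟶ A₀.baseChange ℂ)))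
    (v : HeightOneSpectrum (𝓞 L)) (R : A₀.GoodReductionAt v) (S : B₀.GoodReductionAt v)
    (H : HomReduction R S) (H' : HomReduction S R) {ℓ : ℕ} [Fact ℓ.Prime]
    (TA : R.TateSpecialisation ℓ) (TB : S.TateSpecialisation ℓ)
    (hH : H.IsTateCompatible TA TB) (hH' : H'.IsTateCompatible TB TA) (hℓv : (ℓ : 𝓞 L) ∉ v.asIdeal)
    (Ψ : R.reduction ≅ S.reduction)
    (hΨ : ∀ a : 𝓞 K, (R.redEnd (ιA a) : R.reduction ⟶ R.reduction) ≫ Ψ.hom =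
      Ψ.hom ≫ (S.redEnd (ιB a) : S.reduction ⟶ S.reduction)) :
    ∃ θ : A₀ ≅ B₀, (∀ a : 𝓞 K, (ιA a : A₀ ⟶ A₀) ≫ θ.hom = θ.hom ≫ (ιB a : B₀ ⟶ B₀)) ∧
      H.redHom θ.hom = Ψ.hom := by
  classical
  -- the fractional ideal `I = 𝔞⁻¹𝔟` and its inverse `𝔟⁻¹𝔞`
  set I : FractionalIdeal (𝓞 K)⁰ K := (𝔞 : FractionalIdeal (𝓞 K)⁰ K)⁻¹ * 𝔟 with hIdef
  have hI : I ≠ 0 := mul_ne_zero (inv_ne_zero 𝔞.ne_zero) 𝔟.ne_zero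
  have hIinv : I⁻¹ = ((𝔟 : FractionalIdeal (𝓞 K)⁰ K)⁻¹ * 𝔞 : FractionalIdeal (𝓞 K)⁰ K) := by
    rw [hIdef, mul_inv, inv_inv, mul_comm]
  -- `[K : ℚ] = 2 dim A₀`
  have hK : Module.finrank ℚ K = 2 * A₀.dim := by
    have h1 := CMTypeLattice.two_mul_card_eq_finrank Φ
    have h2 := ξA.finrank_eq_dim
    rw [Module.finrank_fintype_fun_eq_card, AbelianVariety.dim_baseChange] at h2
    omega
  -- (M) the multiplications `m c : A₀ ⟶ B₀` (`c ∈ I`) and `m' c' : B₀ ⟶ A₀` (`c' ∈ I⁻¹`)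
  have hM : ∀ c ∈ I, ∃ m : A₀ ⟶ B₀, (∀ a : 𝓞 K, (ιA a : A₀ ⟶ A₀) ≫ m = m ≫ (ιB a : B₀ ⟶ B₀)) ∧
      ∀ u : K, AlgPoints.map (Hom.baseChange ℂ m).hom.hom.hom (ξA.r u) = ξB.r (c * u) :=
    fun c hc => CMTypeUniformization.exists_hom_baseChange_map_r_eq ξA ξB hAB hc
  choose! m hmι hmr using hM
  have hM' : ∀ c' ∈ I⁻¹, ∃ m' : B₀ ⟶ A₀, (∀ a : 𝓞 K, (ιB a : B₀ ⟶ B₀) ≫ m' = m' ≫ (ιA a : A₀ ⟶ A₀)) ∧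
      ∀ u : K, AlgPoints.map (Hom.baseChange ℂ m').hom.hom.hom (ξB.r u) = ξA.r (c' * u) := by
    intro c' hc'
    rw [hIinv] at hc'
    exact CMTypeUniformization.exists_hom_baseChange_map_r_eq ξB ξA hBA hc'
  choose! m' hm'ι hm'r using hM'
  -- `Ψ⁻¹` is equivariant too
  have hΨ' : ∀ a : 𝓞 K, (S.redEnd (ιB a) : S.reduction ⟶ S.reduction) ≫ Ψ.inv =
      Ψ.inv ≫ (R.redEnd (ιA a) : R.reduction ⟶ R.reduction) := fun a => by
    rw [Iso.comp_inv_eq, Category.assoc, Iso.eq_inv_comp, hΨ a]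
  -- (X) `H.redHom (m c) ≫ Ψ⁻¹ = redEnd (ιA (γ₀ c))`
  have hX : ∀ c ∈ I, ∃ b : 𝓞 K,
      (R.redEnd (ιA b) : R.reduction ⟶ R.reduction) = H.redHom (m c) ≫ Ψ.inv := by
    intro c hc
    refine R.exists_redEnd_eq_of_forall_comp_eq ιA hK fun a => ?_
    rw [← Category.assoc, H.redEnd_comp_redHom_eq_of_comp_eq (hmι c hc a), Category.assoc, hΨ' a,
      Category.assoc]
  choose! γ₀ hγ₀ using hX
  -- (Y) `Ψ ≫ H'.redHom (m' c') = redEnd (ιA (γ₁ c'))`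
  have hY : ∀ c' ∈ I⁻¹, ∃ b : 𝓞 K,
      (R.redEnd (ιA b) : R.reduction ⟶ R.reduction) = Ψ.hom ≫ H'.redHom (m' c') := by
    intro c' hc'
    refine R.exists_redEnd_eq_of_forall_comp_eq ιA hK fun a => ?_
    rw [← Category.assoc, hΨ a, Category.assoc, H'.redEnd_comp_redHom_eq_of_comp_eq (hm'ι c' hc' a),
      Category.assoc]
  choose! γ₁ hγ₁ using hY
  -- `redEnd ∘ ιA` is injective
  have hK' : Module.finrank ℚ K = 2 * R.reduction.dim := by rw [R.dim_reduction]; exact hK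
  have hinj : Function.Injective (R.redEnd.comp ιA) := injective_of_finrank_eq_two_mul_dim _ hK'
  -- (hmul) `γ₀ x · γ₁ y = x y` for `x ∈ I`, `y ∈ I⁻¹`
  have hmul : ∀ x ∈ I, ∀ y ∈ I⁻¹, (γ₀ x : K) * (γ₁ y : K) = x * y := by
    intro x hx y hy
    have hxy : x * y ∈ (1 : FractionalIdeal (𝓞 K)⁰ K) := by
      rw [← mul_inv_cancel₀ hI]
      exact FractionalIdeal.mul_mem_mul hx hy
    obtain ⟨z, hz⟩ := (FractionalIdeal.mem_one_iff (𝓞 K)⁰).mp hxy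
    have hcomp : m x ≫ m' y = (ιA z : A₀ ⟶ A₀) :=
      CMTypeUniformization.comp_eq_of_forall_baseChange_map_r_eq ξA ξB hz (hmr x hx) (hm'r y hy)
    -- reduce: `redEnd ιA (γ₀ x) ≫ redEnd ιA (γ₁ y) = H.redHom (m x) ≫ H'.redHom (m' y) = redEnd (m x ≫ m' y)`
    have h1 : (R.redEnd (ιA (γ₀ x)) : R.reduction ⟶ R.reduction) ≫ (R.redEnd (ιA (γ₁ y)) : _ ⟶ _) =
        (R.redEnd (ιA z) : R.reduction ⟶ R.reduction) := by
      rw [hγ₀ x hx, hγ₁ y hy, Category.assoc, Iso.inv_hom_id_assoc,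
        ← HomReduction.redEnd_comp_eq_redHom_comp_redHom hH hH' hℓv, hcomp]
    have h2 : R.redEnd (ιA (γ₁ y * γ₀ x)) = R.redEnd (ιA z) := by
      rw [map_mul, map_mul, End.mul_def]
      exact h1
    have h3 : γ₁ y * γ₀ x = z := hinj h2
    rw [mul_comm, ← map_mul (algebraMap (𝓞 K) K), h3]
    exact hz
  -- (L) the Dedekind lemma: `I = (g⁻¹)`, `γ₀ = g·`
  have h₀ : ∀ x ∈ I, (fun x => (γ₀ x : K)) x ∈ (1 : FractionalIdeal (𝓞 K)⁰ K) :=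
    fun x _ => FractionalIdeal.coe_mem_one _ _
  have h₁ : ∀ y ∈ I⁻¹, (fun y => (γ₁ y : K)) y ∈ (1 : FractionalIdeal (𝓞 K)⁰ K) :=
    fun y _ => FractionalIdeal.coe_mem_one _ _
  obtain ⟨g, hg, hIg, hγ₀g, -⟩ :=
    Literature.RingTheory.DedekindDomain.FractionalIdeal.eq_spanSingleton_inv_of_forall_mul_eq hI
      (fun x => (γ₀ x : K)) (fun y => (γ₁ y : K)) hmul h₀ h₁
  have hgI : g⁻¹ ∈ I := by rw [hIg]; exact FractionalIdeal.mem_spanSingleton_self _ _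
  have hgI' : g ∈ I⁻¹ := by
    rw [hIg, FractionalIdeal.spanSingleton_inv, inv_inv]; exact FractionalIdeal.mem_spanSingleton_self _ _
  have hγ₀one : γ₀ g⁻¹ = 1 := by
    apply IsFractionRing.injective (𝓞 K) K
    rw [map_one]
    change (γ₀ g⁻¹ : K) = 1
    rw [hγ₀g _ hgI, mul_inv_cancel₀ hg]
  -- (θ) `θ = m g⁻¹`, inverse `m' g`
  have hθθ' : m g⁻¹ ≫ m' g = 𝟙 A₀ := by
    have h := CMTypeUniformization.comp_eq_of_forall_baseChange_map_r_eq ξA ξB (y := 1)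
      (c := g⁻¹) (c' := g) (by rw [RingOfIntegers.coe_eq_algebraMap, map_one, inv_mul_cancel₀ hg]) (hmr _ hgI) (hm'r _ hgI')
    rw [h, map_one]; rfl
  have hθ'θ : m' g ≫ m g⁻¹ = 𝟙 B₀ := by
    have h := CMTypeUniformization.comp_eq_of_forall_baseChange_map_r_eq ξB ξA (y := 1)
      (c := g) (c' := g⁻¹) (by rw [RingOfIntegers.coe_eq_algebraMap, map_one, mul_inv_cancel₀ hg]) (hm'r _ hgI') (hmr _ hgI)
    rw [h, map_one]; rfl
  refine ⟨⟨m g⁻¹, m' g, hθθ', hθ'θ⟩, fun a => hmι _ hgI a, ?_⟩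
  -- `H.redHom θ = Ψ`
  have h := hγ₀ _ hgI
  rw [hγ₀one, map_one, map_one] at h
  change 𝟙 R.reduction = H.redHom (m g⁻¹) ≫ Ψ.inv at h
  rw [eq_comm, Iso.comp_inv_eq, Category.id_comp] at h
  exact h

end Identification

end Literature.NumberTheory.ComplexMultiplication

end
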